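import Summits.QuantumFields.BalabanUV.Beta.GAN24.FibreRateLegsD3
import Summits.QuantumFields.BalabanUV.Beta.GAN24.FibreRateOfLegs
import Summits.QuantumFields.BalabanUV.Beta.GAN24.FibreRateData

/-!
# `BalabanUV.Beta.GAN24.FibreRate` — binder row G-an2-4 / (CONV-C), road P1-fibre, leaf **P1-L11** of `SKELETON-P1.md` (Part B), THE ASSEMBLY:
# shape (I2′) **`ConvCKOfShapes.RealRateK 3 Lc c (Lc⁻²)`** — the `j`-geometric real-zone one-step rate of the fibre functions in the LITERAL units, for every `Lc ≥ 2`

NOT IN PRINT; OUR PROOF ATTEMPT.  HONEST FRAMING (cell contract, verbatim): «discharging `BetaPertH` makes Bałaban's UV stability UNCONDITIONAL — a real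
constructive-QFT result; it is NOT the continuum limit and NOT the Clay problem.»  HONEST DEPENDENCY (verbatim): «continuum YM on T⁴ ⇐ BetaPertH ∧ nine spine
estimates (0/9 proved); BetaPertH ⇐ (D1) ∧ (D4) ∧ CAP+tail; G-an2-4 gates asym, D1 and NE2/3/4.»  [folklore] final bookkeeping of row L11, everything BY NAME:
PART T (leaf-11-g7: `FibreRateTBlockSum.norm_tSum_step_le`), PART S (leaf-07-g6: `SourceSideBound.norm_srcPhi_fhatF_le`/`norm_srcC_fhatF_le`,
`SourceSideRate.srcC_rate`, `SourceSideRatePhiSum.srcPhi_rate`, and the conjugation identities `readingPhi_eq`/`readingC_eq` which make the reading-side sums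
`R = −conj S`), PART C+F (this seat: `CapacitanceEndpoint(Blocks)`, `CapacitanceRate{,Dictionary,Scaled}`, `FibreRate{MM,MF,Feed,FeedFF,LegsD3,OfLegs}`); no
cited fact, no wall binder, no `def … : Prop` hypothesis; 5 `def`s = explicit real constants (`uPhi uC vC` = the pole-free zone envelopes of PART S's data `bPhi bC rC` of part 1/2
`GAN24/FibreRateData`; `cMF cFF` = leg constants).  EVERY POLE CANCELS: the Cap⁻¹ block orders `|q|², |q|³, |q|⁴` (L08) and block-rate orders
`|q|⁴, |q|⁵, |q|⁶` (PART C) meet PART S's `1/|q|², 1/|q|³, 1/√|q|` exactly (`momSq_mul_bPhi`, `cube_mul_bC`, `sqrt_mul_rC`).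
HONEST (TRIGGER-P1 c4): `RealRateK 3 Lc c θ` is shape (I2′) = ONE of the two inputs of the carver's L12 (`ConvCKOfShapes.convCK_of_shapes` needs (I3′) = L10 as
well); it discharges NOTHING of (CONV-C)'s K-slot `ConvCK 3 Lc` by itself; 0 wall binders instantiated; NOT `BetaPertH`, NOT continuum, NOT Clay.

## What is proved (`d = 3`; every `Lc ≥ 2`)
* §1 = part 1/2 `GAN24/FibreRateData` (PART S's data `bPhi bC rPhi rC` in this seat's shapes, reading side by `R = −conj S`);
* §2 the pole-free envelopes: `s²·bPhi = aφ + bφ s²`, `s³·bC = a_c + b_c s³`, `s·rC = rcPole + rcBox·s` (`s = √momSq q ≤ 2π`);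
* §3 the three legs with `q`-UNIFORM constants: `mf_leg`, `fm_leg` (`≤ cMF Lc·(Lc⁻²)^j`), `ff_leg` (`≤ cFF Lc·(Lc⁻²)^j`);
* §4 **`realRateK : 2 ≤ Lc → RealRateK 3 Lc (cFF Lc + cMF Lc + cMF Lc + cmm Lc) ((Lc:ℝ)^2)⁻¹`** (`FibreRateOfLegs.realRateK_of_leg_rates`).

Unit `b2b-balaban-gan24-formalise-leaf-20` (G-an2-4 formalisation swarm, leaf prover 20), 2026-08-20.  Value = the kernel-checked shape (I2′) of the K-slot route
P1 of binder row G-an2-4 — NOT the K-slot, NOT summit progress.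
-/

noncomputable section

open Complex Finset
open scoped BigOperators Real ComplexConjugate

namespace Summit.QuantumFields.BalabanUV.Beta.GAN24.FibreRate

open Literature.Probability.LatticeModels (TorusSite)
open Literature.MathematicalPhysics.QuantumFieldTheory.Balaban1983to89.B4Strip (ofRealVec)
open Literature.MathematicalPhysics.QuantumFieldTheory.Balaban1983to89.B4ContourShift (BZ)
open Literature.MathematicalPhysics.QuantumFieldTheory.King1986 (momSq momSq_nonneg)
open AliasObjects (cap phiSol cSol srcPhi srcC readW Ahat fhatF eVec reg reg_eq_univ conj_ofRealVec)
open FibreRateFeedTerms (rPhiTerm rCTerm)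
open FibreRateTBlockSum (tSum tConst tConst_nonneg norm_tSum_step_le)
open CombesThomas (sfStep smStep)
open ConvCKOfShapes (RealRateK)
open CapacitanceEndpointBlocks (cPP cPc ccc cPP_pos cPc_pos ccc_pos)
open CapacitanceScalarBounds (momSq_pos)
open CapacitanceScalarDictionary (LAl_ofRealVec_ne_zero)
open CapacitanceRateScaled (crPP crPc crcc momSq_le)
open SourceSideBound (norm_srcPhi_fhatF_le norm_srcC_fhatF_le)
open SourceSideRate (rcPole rcBox rcPole_nonneg rcBox_nonneg srcC_rate)
open SourceSideRatePhiSum (rPhiPole rPhiBox rPhiPole_nonneg rPhiBox_nonneg srcPhi_rate readingPhi_eq readingC_eq)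
open FibreRateMF (mf_rate_of_source_data)
open FibreRateLegsD3 (fm_rate_of_reading_data ff_rate_of_data)
open FibreRateOfLegs (cmm realRateK_of_leg_rates abs_le_pi_of_mem_BZ crPP_nonneg)

open FibreRateData (bPhi bC rPhi rC rPhi_nonneg srcPhi_bound srcC_bound srcPhi_rate' srcC_rate' rPhi_bound rC_bound rPhi_rate rC_rate)

variable {Lc : ℕ} [NeZero Lc]

/-! ## §2 The pole-free envelopes on the zone -/

/-- The zone envelope of `|q|²·bPhi`: `uPhi Lc = (π²/8 + π⁴/32) + (1 + Lc)/8·(1 + 4Lc)^4·(4π²)`. -/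
def uPhi (Lc : ℕ) : ℝ := (π ^ 2 / 8 + π ^ 4 / 32) + (1 + (Lc : ℝ)) / 8 * (1 + 4 * (Lc : ℝ)) ^ (3 + 1) * (4 * π ^ 2)

/-- The zone envelope of `|q|³·bC`: `uC Lc = π⁴/16 + Lc/8·(1 + 4Lc)^4·(8π³)`. -/
def uC (Lc : ℕ) : ℝ := π ^ 4 / 16 + (Lc : ℝ) / 8 * (1 + 4 * (Lc : ℝ)) ^ (3 + 1) * (8 * π ^ 3)

/-- The zone envelope of `|q|·rC`: `vC Lc = rcPole + rcBox 4 Lc·(2π)`. -/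
def vC (Lc : ℕ) : ℝ := rcPole + rcBox (3 + 1) Lc * (2 * π)

section Envelopes
variable {q : Fin (3 + 1) → ℝ}

/-- [folklore] On the zone `√|q|² ≤ 2π` and `|q|² ≤ 4π²`. -/
theorem sqrt_momSq_le (hq : ∀ i, |q i| ≤ π) : Real.sqrt (momSq q) ≤ 2 * π ∧ momSq q ≤ 4 * π ^ 2 := by
  have hP : momSq q ≤ 4 * π ^ 2 := by have h := momSq_le hq; norm_num at h; linarith
  refine ⟨?_, hP⟩
  calc Real.sqrt (momSq q) ≤ Real.sqrt (4 * π ^ 2) := Real.sqrt_le_sqrt hP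
    _ = 2 * π := by rw [show (4 * π ^ 2 : ℝ) = (2 * π) ^ 2 by ring, Real.sqrt_sq (by positivity)]

omit [NeZero Lc] in
/-- [folklore] **THE `S_φ` POLE CANCELS**: `s²·bPhi = (π²/8 + π⁴/32) + (1 + Lc)/8(1 + 4Lc)^4·s²` (`s = √|q|²`, `q ≠ 0`), hence `≤ uPhi Lc`, and `0 ≤ s²·bPhi`. -/
theorem sq_mul_bPhi (hq : ∀ i, |q i| ≤ π) (hq0 : q ≠ 0) :
    Real.sqrt (momSq q) ^ 2 * bPhi Lc q ≤ uPhi Lc ∧ 0 ≤ Real.sqrt (momSq q) ^ 2 * bPhi Lc q := by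
  have hP := momSq_pos hq0
  have e : Real.sqrt (momSq q) ^ 2 * bPhi Lc q = (π ^ 2 / 8 + π ^ 4 / 32) + (1 + (Lc : ℝ)) / 8 * (1 + 4 * (Lc : ℝ)) ^ (3 + 1) * momSq q := by
    rw [Real.sq_sqrt hP.le]; unfold bPhi; field_simp
  rw [e]; unfold uPhi
  refine ⟨by gcongr; exact (sqrt_momSq_le hq).2, by positivity⟩

omit [NeZero Lc] in
/-- [folklore] **THE `S_c` POLE CANCELS**: `s³·bC = π⁴/16 + Lc/8(1 + 4Lc)^4·s³ ≤ uC Lc`, and `0 ≤ s³·bC`. -/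
theorem cube_mul_bC (hq : ∀ i, |q i| ≤ π) (hq0 : q ≠ 0) :
    Real.sqrt (momSq q) ^ 3 * bC Lc q ≤ uC Lc ∧ 0 ≤ Real.sqrt (momSq q) ^ 3 * bC Lc q := by
  have hP := momSq_pos hq0
  have hs : 0 < Real.sqrt (momSq q) := Real.sqrt_pos.2 hP
  have e : Real.sqrt (momSq q) ^ 3 * bC Lc q = π ^ 4 / 16 + (Lc : ℝ) / 8 * (1 + 4 * (Lc : ℝ)) ^ (3 + 1) * Real.sqrt (momSq q) ^ 3 := by
    have h3 : momSq q * Real.sqrt (momSq q) = Real.sqrt (momSq q) ^ 3 := by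
      nth_rewrite 1 [← Real.sq_sqrt hP.le]; ring
    unfold bC; rw [h3]; field_simp
  rw [e]; unfold uC
  have h3 : Real.sqrt (momSq q) ^ 3 ≤ 8 * π ^ 3 := by
    calc Real.sqrt (momSq q) ^ 3 ≤ (2 * π) ^ 3 := pow_le_pow_left₀ hs.le (sqrt_momSq_le hq).1 3
      _ = 8 * π ^ 3 := by ring
  refine ⟨by gcongr, by positivity⟩

omit [NeZero Lc] in
/-- [folklore] **THE `S_c`-RATE POLE CANCELS**: `s·rC = rcPole + rcBox 4 Lc·s ≤ vC Lc`, and `0 ≤ s·rC`. -/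
theorem sqrt_mul_rC (hq : ∀ i, |q i| ≤ π) (hq0 : q ≠ 0) :
    Real.sqrt (momSq q) * rC Lc q ≤ vC Lc ∧ 0 ≤ Real.sqrt (momSq q) * rC Lc q := by
  have hP := momSq_pos hq0
  have hs : 0 < Real.sqrt (momSq q) := Real.sqrt_pos.2 hP
  have e : Real.sqrt (momSq q) * rC Lc q = rcPole + rcBox (3 + 1) Lc * Real.sqrt (momSq q) := by
    unfold rC; field_simp
  rw [e]; unfold vC
  have := rcPole_nonneg; have := rcBox_nonneg (3 + 1) Lc
  refine ⟨by gcongr; exact (sqrt_momSq_le hq).1, by positivity⟩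

end Envelopes

/-! ## §3 The three legs with `q`-uniform constants -/

/-- The mf/fm LEG CONSTANT `cMF Lc = (4(crPP·4π²·uPhi + cPP·4π²·rPhi) + crPc·4π²·uC + cPc·4π²·vC)/Lc^7` (constants of `D = 4`). -/
def cMF (Lc : ℕ) : ℝ :=
  ((3 + 1 : ℕ) * (crPP (3 + 1) * (4 * π ^ 2) * uPhi Lc + cPP (3 + 1) * (4 * π ^ 2) * rPhi Lc)
    + crPc (3 + 1) * (4 * π ^ 2) * uC Lc + cPc (3 + 1) * (4 * π ^ 2) * vC Lc) / (Lc : ℝ) ^ 7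

/-- The ff LEG CONSTANT (T-sum + feed share; see the module docstring for the factorisation). -/
def cFF (Lc : ℕ) : ℝ :=
  (tConst Lc (3 + 1)
    + ((3 + 1 : ℕ) * (rPhi Lc * ((3 + 1 : ℕ) * cPP (3 + 1) * uPhi Lc + cPc (3 + 1) * uC Lc)
        + ((3 + 1 : ℕ) * crPP (3 + 1) * uPhi Lc ^ 2 + (3 + 1 : ℕ) * cPP (3 + 1) * uPhi Lc * rPhi Lc
          + crPc (3 + 1) * uPhi Lc * uC Lc + cPc (3 + 1) * uPhi Lc * vC Lc))
      + ((3 + 1 : ℕ) * cPc (3 + 1) * vC Lc * uPhi Lc + ccc (3 + 1) * vC Lc * uC Lc)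
      + ((3 + 1 : ℕ) * crPc (3 + 1) * uC Lc * uPhi Lc + (3 + 1 : ℕ) * cPc (3 + 1) * uC Lc * rPhi Lc
          + crcc (3 + 1) * uC Lc ^ 2 + ccc (3 + 1) * uC Lc * vC Lc))) / (Lc : ℝ) ^ 4

section Legs
variable (Lc)

/-- [folklore] `0 ≤ crPc D`. -/
theorem crPc_nonneg (D : ℕ) : 0 ≤ crPc D := by
  unfold CapacitanceRateScaled.crPc
  have := CapacitanceRateScaled.rateA_nonneg D; have := CapacitanceRateScaled.rateS_nonneg D
  have := CapacitanceEndpointBlocks.gFac_pos D (by positivity : (0 : ℝ) ≤ D * π ^ 2)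
  positivity

/-- [folklore] `0 ≤ crcc D`. -/
theorem crcc_nonneg (D : ℕ) : 0 ≤ crcc D := by
  unfold CapacitanceRateScaled.crcc
  have := CapacitanceRateScaled.rateA_nonneg D; have := CapacitanceRateScaled.rateS_nonneg D
  have := CapacitanceEndpointBlocks.gFac_pos D (by positivity : (0 : ℝ) ≤ D * π ^ 2)
  positivity

variable {Lc}

/-- **mf LEG** [folklore]: `‖sm_{j+1}sf_{j+1}·φ′_κ − sm_j sf_j·φ_κ‖ ≤ cMF Lc·(Lc⁻²)^j` on `BZ ∖ {0}` (`FibreRateMF.mf_rate_of_source_data` ∘ PART S). -/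
theorem mf_leg (j : ℕ) {q : Fin (3 + 1) → ℝ} (hq : q ∈ BZ (3 + 1)) (hq0 : q ≠ 0) (κ l : Fin (3 + 1)) (y' : Fin (3 + 1) → ℤ) :
    ‖((smStep 3 Lc (j + 1) * sfStep Lc (j + 1) : ℝ) : ℂ) *
          phiSol (Lc ^ (j + 2)) (ofRealVec q) (fhatF (Lc ^ (j + 2)) (Lc ^ (j + 1)) (ofRealVec q) l y') 0 κ
        - ((smStep 3 Lc j * sfStep Lc j : ℝ) : ℂ) * phiSol (Lc ^ (j + 1)) (ofRealVec q) (fhatF (Lc ^ (j + 1)) (Lc ^ j) (ofRealVec q) l y') 0 κ‖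
      ≤ cMF Lc * (((Lc : ℝ) ^ 2)⁻¹) ^ j := by
  have hq' := abs_le_pi_of_mem_BZ hq
  have hLc1 : 1 ≤ Lc := Nat.one_le_iff_ne_zero.2 (NeZero.ne Lc)
  have hLc0 : (0 : ℝ) < Lc := by exact_mod_cast hLc1
  have hNM : Lc ^ (j + 1) = Lc ^ j * Lc := pow_succ Lc j
  have hN'M' : Lc ^ (j + 2) = Lc ^ (j + 1) * Lc := pow_succ Lc (j + 1)
  have hNN' : Lc ^ (j + 1) ≤ Lc ^ (j + 2) := Nat.pow_le_pow_right hLc1 (by omega)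
  have h := mf_rate_of_source_data j hq' hq0 (srcPhi_bound hN'M' hq' hq0 l y') (srcC_bound hN'M' hq' hq0 l y')
    (srcPhi_rate' hNM hN'M' hNN' hq' hq0 l y') (srcC_rate' hNM hN'M' hNN' hq' hq0 l y') κ
  refine h.trans (mul_le_mul_of_nonneg_right (div_le_div_of_nonneg_right ?_ (by positivity)) (by positivity))
  -- q-uniformisation
  have hP := momSq_pos hq0
  set s := Real.sqrt (momSq q) with hs
  have hsP : momSq q = s ^ 2 := (Real.sq_sqrt hP.le).symm
  obtain ⟨hxφ, hxφ0⟩ := sq_mul_bPhi (Lc := Lc) hq' hq0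
  obtain ⟨hxc, hxc0⟩ := cube_mul_bC (Lc := Lc) hq' hq0
  obtain ⟨hyc, hyc0⟩ := sqrt_mul_rC (Lc := Lc) hq' hq0
  obtain ⟨hs2π, hP4⟩ := sqrt_momSq_le hq'
  have hs0 : 0 ≤ s := Real.sqrt_nonneg _
  have hss : s ^ 2 ≤ 4 * π ^ 2 := by rw [← hsP]; exact hP4
  have h1 := (cPP_pos (3 + 1)).le; have h2 := (cPc_pos (3 + 1)).le; have h3 := crPP_nonneg (3 + 1); have h4 := crPc_nonneg (3 + 1)
  have h5 := rPhi_nonneg Lc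
  have hU1 : 0 ≤ uPhi Lc := hxφ0.trans hxφ
  have hU2 : 0 ≤ uC Lc := hxc0.trans hxc
  have hU3 : 0 ≤ vC Lc := hyc0.trans hyc
  rw [hsP]
  calc ((3 + 1 : ℕ) : ℝ) * (crPP (3 + 1) * (s ^ 2) ^ 2 * bPhi Lc q + cPP (3 + 1) * s ^ 2 * rPhi Lc)
        + crPc (3 + 1) * ((s ^ 2) ^ 2 * s) * bC Lc q + cPc (3 + 1) * (s ^ 2 * s) * rC Lc q
      = ((3 + 1 : ℕ) : ℝ) * (crPP (3 + 1) * s ^ 2 * (s ^ 2 * bPhi Lc q) + cPP (3 + 1) * s ^ 2 * rPhi Lc)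
        + crPc (3 + 1) * s ^ 2 * (s ^ 3 * bC Lc q) + cPc (3 + 1) * s ^ 2 * (s * rC Lc q) := by
          ring
    _ ≤ ((3 + 1 : ℕ) : ℝ) * (crPP (3 + 1) * (4 * π ^ 2) * uPhi Lc + cPP (3 + 1) * (4 * π ^ 2) * rPhi Lc)
        + crPc (3 + 1) * (4 * π ^ 2) * uC Lc + cPc (3 + 1) * (4 * π ^ 2) * vC Lc := by gcongr

/-- **fm LEG** [folklore]: `‖sf_{j+1}sm_{j+1}·F_{j+1} − sf_j sm_j·F_j‖ ≤ cMF Lc·(Lc⁻²)^j` on `BZ ∖ {0}` (`FibreRateLegsD3.fm_rate_of_reading_data` ∘ (R = −conj S) ∘ PART S). -/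
theorem fm_leg (j : ℕ) {q : Fin (3 + 1) → ℝ} (hq : q ∈ BZ (3 + 1)) (hq0 : q ≠ 0) (κ l : Fin (3 + 1)) (x' : Fin (3 + 1) → ℤ) :
    ‖((sfStep Lc (j + 1) * smStep 3 Lc (j + 1) : ℝ) : ℂ) * ∑ m', readW (Lc ^ (j + 2)) (Lc ^ (j + 1)) (ofRealVec q) m' κ x' *
          Ahat (Lc ^ (j + 2)) (ofRealVec q) 0 (eVec l) m' κ
        - ((sfStep Lc j * smStep 3 Lc j : ℝ) : ℂ) * ∑ m, readW (Lc ^ (j + 1)) (Lc ^ j) (ofRealVec q) m κ x' *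
          Ahat (Lc ^ (j + 1)) (ofRealVec q) 0 (eVec l) m κ‖
      ≤ cMF Lc * (((Lc : ℝ) ^ 2)⁻¹) ^ j := by
  have hq' := abs_le_pi_of_mem_BZ hq
  have hLc1 : 1 ≤ Lc := Nat.one_le_iff_ne_zero.2 (NeZero.ne Lc)
  have hLc0 : (0 : ℝ) < Lc := by exact_mod_cast hLc1
  have hNM : Lc ^ (j + 1) = Lc ^ j * Lc := pow_succ Lc j
  have hN'M' : Lc ^ (j + 2) = Lc ^ (j + 1) * Lc := pow_succ Lc (j + 1)
  have hNN' : Lc ^ (j + 1) ≤ Lc ^ (j + 2) := Nat.pow_le_pow_right hLc1 (by omega)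
  have h := fm_rate_of_reading_data j hq' hq0 κ l x' (rPhi_bound hNM hq' hq0 κ x') (rC_bound hNM hq' hq0 κ x')
    (rPhi_rate hNM hN'M' hNN' hq' hq0 κ x') (rC_rate hNM hN'M' hNN' hq' hq0 κ x')
  refine h.trans (mul_le_mul_of_nonneg_right (div_le_div_of_nonneg_right ?_ (by positivity)) (by positivity))
  have hP := momSq_pos hq0
  set s := Real.sqrt (momSq q) with hs
  have hsP : momSq q = s ^ 2 := (Real.sq_sqrt hP.le).symm
  obtain ⟨hxφ, hxφ0⟩ := sq_mul_bPhi (Lc := Lc) hq' hq0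
  obtain ⟨hxc, hxc0⟩ := cube_mul_bC (Lc := Lc) hq' hq0
  obtain ⟨hyc, hyc0⟩ := sqrt_mul_rC (Lc := Lc) hq' hq0
  obtain ⟨hs2π, hP4⟩ := sqrt_momSq_le hq'
  have hs0 : 0 ≤ s := Real.sqrt_nonneg _
  have hss : s ^ 2 ≤ 4 * π ^ 2 := by rw [← hsP]; exact hP4
  have h1 := (cPP_pos (3 + 1)).le; have h2 := (cPc_pos (3 + 1)).le; have h3 := crPP_nonneg (3 + 1); have h4 := crPc_nonneg (3 + 1)
  have h5 := rPhi_nonneg Lc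
  have hU1 : 0 ≤ uPhi Lc := hxφ0.trans hxφ
  have hU2 : 0 ≤ uC Lc := hxc0.trans hxc
  have hU3 : 0 ≤ vC Lc := hyc0.trans hyc
  rw [hsP]
  calc ((3 + 1 : ℕ) : ℝ) * (rPhi Lc * (cPP (3 + 1) * s ^ 2) + bPhi Lc q * (crPP (3 + 1) * (s ^ 2) ^ 2))
        + rC Lc q * (cPc (3 + 1) * (s ^ 2 * s)) + bC Lc q * (crPc (3 + 1) * ((s ^ 2) ^ 2 * s))
      = ((3 + 1 : ℕ) : ℝ) * (crPP (3 + 1) * s ^ 2 * (s ^ 2 * bPhi Lc q) + cPP (3 + 1) * s ^ 2 * rPhi Lc)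
        + crPc (3 + 1) * s ^ 2 * (s ^ 3 * bC Lc q) + cPc (3 + 1) * s ^ 2 * (s * rC Lc q) := by
          ring
    _ ≤ ((3 + 1 : ℕ) : ℝ) * (crPP (3 + 1) * (4 * π ^ 2) * uPhi Lc + cPP (3 + 1) * (4 * π ^ 2) * rPhi Lc)
        + crPc (3 + 1) * (4 * π ^ 2) * uC Lc + cPc (3 + 1) * (4 * π ^ 2) * vC Lc := by gcongr

/-- **ff LEG** [folklore]: `‖sf_{j+1}²·FF_{j+1} − sf_j²·FF_j‖ ≤ cFF Lc·(Lc⁻²)^j` on `BZ ∖ {0}` for `Lc ≥ 2` (`FibreRateLegsD3.ff_rate_of_data` ∘ PART T ∘ PART S). -/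
theorem ff_leg (hLc2 : 2 ≤ Lc) (j : ℕ) {q : Fin (3 + 1) → ℝ} (hq : q ∈ BZ (3 + 1)) (hq0 : q ≠ 0) (κ l : Fin (3 + 1))
    (x' y' : Fin (3 + 1) → ℤ) :
    ‖((sfStep Lc (j + 1) * sfStep Lc (j + 1) : ℝ) : ℂ) * ∑ m', readW (Lc ^ (j + 2)) (Lc ^ (j + 1)) (ofRealVec q) m' κ x' *
          Ahat (Lc ^ (j + 2)) (ofRealVec q) (fhatF (Lc ^ (j + 2)) (Lc ^ (j + 1)) (ofRealVec q) l y') 0 m' κ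
        - ((sfStep Lc j * sfStep Lc j : ℝ) : ℂ) * ∑ m, readW (Lc ^ (j + 1)) (Lc ^ j) (ofRealVec q) m κ x' *
          Ahat (Lc ^ (j + 1)) (ofRealVec q) (fhatF (Lc ^ (j + 1)) (Lc ^ j) (ofRealVec q) l y') 0 m κ‖
      ≤ cFF Lc * (((Lc : ℝ) ^ 2)⁻¹) ^ j := by
  have hq' := abs_le_pi_of_mem_BZ hq
  have hLc1 : 1 ≤ Lc := by omega
  have hLc0 : (0 : ℝ) < Lc := by exact_mod_cast hLc1
  have hNM : Lc ^ (j + 1) = Lc ^ j * Lc := pow_succ Lc j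
  have hN'M' : Lc ^ (j + 2) = Lc ^ (j + 1) * Lc := pow_succ Lc (j + 1)
  have hNN' : Lc ^ (j + 1) ≤ Lc ^ (j + 2) := Nat.pow_le_pow_right hLc1 (by omega)
  have hT : ‖tSum (Lc ^ (j + 2)) (Lc ^ (j + 1)) q κ l x' y' - tSum (Lc ^ (j + 1)) (Lc ^ j) q κ l x' y'‖
      ≤ tConst Lc (3 + 1) / (((Lc ^ (j + 1) : ℕ) : ℝ)) ^ 2 := by
    have h := norm_tSum_step_le hLc2 j hq' κ l x' y'
    push_cast
    exact h
  have h := ff_rate_of_data j hq' hq0 κ l x' y' hT (rPhi_bound hNM hq' hq0 κ x') (rC_bound hNM hq' hq0 κ x')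
    (rPhi_rate hNM hN'M' hNN' hq' hq0 κ x') (rC_rate hNM hN'M' hNN' hq' hq0 κ x') (srcPhi_bound hN'M' hq' hq0 l y')
    (srcC_bound hN'M' hq' hq0 l y') (srcPhi_rate' hNM hN'M' hNN' hq' hq0 l y') (srcC_rate' hNM hN'M' hNN' hq' hq0 l y')
  refine h.trans (mul_le_mul_of_nonneg_right (div_le_div_of_nonneg_right ?_ (by positivity)) (by positivity))
  have hP := momSq_pos hq0
  set s := Real.sqrt (momSq q) with hs
  have hsP : momSq q = s ^ 2 := (Real.sq_sqrt hP.le).symm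
  obtain ⟨hxφ, hxφ0⟩ := sq_mul_bPhi (Lc := Lc) hq' hq0
  obtain ⟨hxc, hxc0⟩ := cube_mul_bC (Lc := Lc) hq' hq0
  obtain ⟨hyc, hyc0⟩ := sqrt_mul_rC (Lc := Lc) hq' hq0
  have hs0 : 0 ≤ s := Real.sqrt_nonneg _
  have h1 := (cPP_pos (3 + 1)).le; have h2 := (cPc_pos (3 + 1)).le; have h3 := crPP_nonneg (3 + 1); have h4 := crPc_nonneg (3 + 1)
  have h5 := rPhi_nonneg Lc; have h6 := (ccc_pos (3 + 1)).le; have h7 := crcc_nonneg (3 + 1)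
  have hU1 : 0 ≤ uPhi Lc := hxφ0.trans hxφ
  have hU2 : 0 ≤ uC Lc := hxc0.trans hxc
  have hU3 : 0 ≤ vC Lc := hyc0.trans hyc
  rw [hsP]
  calc tConst Lc (3 + 1)
        + (((3 + 1 : ℕ) : ℝ) * (rPhi Lc * (((3 + 1 : ℕ) : ℝ) * (cPP (3 + 1) * s ^ 2 * bPhi Lc q) + cPc (3 + 1) * (s ^ 2 * s) * bC Lc q)
              + bPhi Lc q * (((3 + 1 : ℕ) : ℝ) * (crPP (3 + 1) * (s ^ 2) ^ 2 * bPhi Lc q + cPP (3 + 1) * s ^ 2 * rPhi Lc)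
                + crPc (3 + 1) * ((s ^ 2) ^ 2 * s) * bC Lc q + cPc (3 + 1) * (s ^ 2 * s) * rC Lc q))
          + rC Lc q * (((3 + 1 : ℕ) : ℝ) * (cPc (3 + 1) * (s ^ 2 * s) * bPhi Lc q) + ccc (3 + 1) * (s ^ 2) ^ 2 * bC Lc q)
          + bC Lc q * (((3 + 1 : ℕ) : ℝ) * (crPc (3 + 1) * ((s ^ 2) ^ 2 * s) * bPhi Lc q + cPc (3 + 1) * (s ^ 2 * s) * rPhi Lc)
                + crcc (3 + 1) * (s ^ 2) ^ 3 * bC Lc q + ccc (3 + 1) * (s ^ 2) ^ 2 * rC Lc q))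
      = tConst Lc (3 + 1)
        + (((3 + 1 : ℕ) : ℝ) * (rPhi Lc * (((3 + 1 : ℕ) : ℝ) * cPP (3 + 1) * (s ^ 2 * bPhi Lc q) + cPc (3 + 1) * (s ^ 3 * bC Lc q))
            + (((3 + 1 : ℕ) : ℝ) * crPP (3 + 1) * (s ^ 2 * bPhi Lc q) ^ 2 + ((3 + 1 : ℕ) : ℝ) * cPP (3 + 1) * (s ^ 2 * bPhi Lc q) * rPhi Lc
              + crPc (3 + 1) * (s ^ 2 * bPhi Lc q) * (s ^ 3 * bC Lc q) + cPc (3 + 1) * (s ^ 2 * bPhi Lc q) * (s * rC Lc q)))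
          + (((3 + 1 : ℕ) : ℝ) * cPc (3 + 1) * (s * rC Lc q) * (s ^ 2 * bPhi Lc q) + ccc (3 + 1) * (s * rC Lc q) * (s ^ 3 * bC Lc q))
          + (((3 + 1 : ℕ) : ℝ) * crPc (3 + 1) * (s ^ 3 * bC Lc q) * (s ^ 2 * bPhi Lc q) + ((3 + 1 : ℕ) : ℝ) * cPc (3 + 1) * (s ^ 3 * bC Lc q) * rPhi Lc
              + crcc (3 + 1) * (s ^ 3 * bC Lc q) ^ 2 + ccc (3 + 1) * (s ^ 3 * bC Lc q) * (s * rC Lc q))) := by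
          ring
    _ ≤ tConst Lc (3 + 1)
        + (((3 + 1 : ℕ) : ℝ) * (rPhi Lc * (((3 + 1 : ℕ) : ℝ) * cPP (3 + 1) * uPhi Lc + cPc (3 + 1) * uC Lc)
            + (((3 + 1 : ℕ) : ℝ) * crPP (3 + 1) * uPhi Lc ^ 2 + ((3 + 1 : ℕ) : ℝ) * cPP (3 + 1) * uPhi Lc * rPhi Lc
              + crPc (3 + 1) * uPhi Lc * uC Lc + cPc (3 + 1) * uPhi Lc * vC Lc))
          + (((3 + 1 : ℕ) : ℝ) * cPc (3 + 1) * vC Lc * uPhi Lc + ccc (3 + 1) * vC Lc * uC Lc)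
          + (((3 + 1 : ℕ) : ℝ) * crPc (3 + 1) * uC Lc * uPhi Lc + ((3 + 1 : ℕ) : ℝ) * cPc (3 + 1) * uC Lc * rPhi Lc
              + crcc (3 + 1) * uC Lc ^ 2 + ccc (3 + 1) * uC Lc * vC Lc)) := by gcongr

end Legs

/-! ## §4 Row L11: shape (I2′) -/

/-- **ROW P1-L11 — SHAPE (I2′), UNCONDITIONAL** [our proof attempt, kernel-checked]: for every `Lc ≥ 2`,
`ConvCKOfShapes.RealRateK 3 Lc (cFF Lc + cMF Lc + cMF Lc + cmm Lc) (Lc⁻²)` — the `j`-geometric (`θ = Lc⁻²`) real-zone one-step rate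
`‖kFib_{j+1}(p) − kFib_j(p)‖ ≤ c·θ^j` on the whole Brillouin zone, in the LITERAL units `(sfStep Lc, smStep 3 Lc)`, all legs and offsets (`0 ≤ Lc⁻² < 1`: `TransverseDictionary.theta_lt_one`).  This is ONE of the two located
shapes the carver's L12 / `ConvCKOfShapes.convCK_of_shapes` consumes; (I3′) = row L10 is the other; nothing of (CONV-C)'s K-slot is claimed here. -/
theorem realRateK (hLc2 : 2 ≤ Lc) : RealRateK 3 Lc (cFF Lc + cMF Lc + cMF Lc + cmm Lc) (((Lc : ℝ) ^ 2)⁻¹) :=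
  realRateK_of_leg_rates (fun j _ hq hq0 κ l x' y' => ff_leg hLc2 j hq hq0 κ l x' y') (fun j _ hq hq0 κ l x' => fm_leg j hq hq0 κ l x')
    (fun j _ hq hq0 κ l y' => mf_leg j hq hq0 κ l y')

end Summit.QuantumFields.BalabanUV.Beta.GAN24.FibreRate

end
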